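import Summits.NavierStokesRegularity.FluidComputer.AngularGalerkinLadder

/-!
# The angular Galerkin ladder: the zero field, monotonicity in the level, smoothness and
# linearity of the Casimir cut (theorems only)

Cell `ns-blowup`, seat `ns-blowup-lean` (g10). LABEL: KERNEL typing hygiene for the vocabulary of
`FluidComputer/AngularGalerkinLadder.lean` (route `Theses/AngularGalerkinLadder.lean`). WHAT THIS IS
NOT: not Navier–Stokes evidence — elementary identities about the rotation generators `angGen`, the
Casimir operator `casimir`, the band defect `bandDefect` and the classes `IsBandLimited L`,
`IsCobandLimited L`; nothing is asserted about any rung dynamics, no profile is constructed.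

## Content

§1 The zero field is band-limited and co-band-limited at every level; `bandDefect (L+1) u = 0`
once `bandDefect L u = 0` (`bandDefect_succ_eq_zero`), hence **monotonicity in the level**
`IsBandLimited L u → IsBandLimited L' u` for `L ≤ L'` (`IsBandLimited.mono`: the ranges of the
isotypic projections `Π_L` increase) and dually `IsCobandLimited L' g → IsCobandLimited L g`
(`IsCobandLimited.anti`); the velocity slices of a rung-`L` solution are band-limited at every
level `L' ≥ L`.

§2 **Smoothness and linearity.** For smooth `u` the fields `angGen a u`, `casimir u`,
`bandDefect L u` are smooth (`contDiff_angGen/…casimir/…bandDefect`); `angGen a` is additive and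
homogeneous on differentiable fields, `casimir` and `bandDefect L` on smooth fields
(`casimir_add/…smul`, `bandDefect_add/…smul`); hence `IsBandLimited L` is closed under `+`, scalar
multiples, `−` (a real vector space of smooth fields — the range of `Π_L`), and `IsCobandLimited L`
is closed under scalar multiples, negation and — for continuous fields — sums.

Typing remark (for the route's refuters, not used here): `IsCobandLimited L g` quantifies Bochner
integrals `∫⟪g, ψ⟫`, which take the junk value `0` on non-integrable integrands; for a field `g`
that is not locally integrable the predicate can therefore hold vacuously. Inside
`IsRungSolutionOn` this is harmless: the defect `d t` equals `∂ₜu + (u·∇)u − νΔu + ∇p` pointwise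
(`IsClassicalNSSolutionOn.momentum`), a smooth field, and `⟪d t, ψ⟫` with `ψ` compactly supported
and continuous is integrable.

References: [cite: BullardGellman1954] (vector spherical harmonics; the degree filtration);
[cite: Tao2016AveragedNS, Thm. 1.5] (rotation averages as order-zero multipliers).
-/

noncomputable section

namespace Summit.NavierStokesRegularity.FluidComputer

open Set MeasureTheory Filter Topology Function
open scoped ContDiff RealInnerProductSpace
open Literature.Analysis.FluidPDE

namespace AngularLadder


/-! ## §1 The zero field; monotonicity in the level -/

/-- The generators kill the zero field: `J_a 0 = 0`. [folklore] -/
theorem angGen_zero (a : Fin 3) :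
    angGen a (0 : EuclideanSpace ℝ (Fin 3) → EuclideanSpace ℝ (Fin 3)) = 0 := by
  funext x
  simp [angGen, cross]

/-- The Casimir kills the zero field: `𝒞 0 = 0`. [folklore] -/
theorem casimir_zero : casimir (0 : EuclideanSpace ℝ (Fin 3) → EuclideanSpace ℝ (Fin 3)) = 0 := by
  funext x
  simp [casimir, angGen_zero]

/-- Every band defect of the zero field vanishes. [folklore] -/
theorem bandDefect_zero_field (L : ℕ) :
    bandDefect L (0 : EuclideanSpace ℝ (Fin 3) → EuclideanSpace ℝ (Fin 3)) = 0 := by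
  induction L with
  | zero => exact casimir_zero
  | succ L ih =>
      funext x
      simp [bandDefect, ih, casimir_zero]

/-- The zero field is band-limited at every level. [folklore] -/
theorem isBandLimited_zero_field (L : ℕ) :
    IsBandLimited L (0 : EuclideanSpace ℝ (Fin 3) → EuclideanSpace ℝ (Fin 3)) :=
  ⟨contDiff_const, fun x => by rw [bandDefect_zero_field]; rfl⟩

/-- The zero field is co-band-limited at every level. [folklore] -/
theorem isCobandLimited_zero_field (L : ℕ) :
    IsCobandLimited L (0 : EuclideanSpace ℝ (Fin 3) → EuclideanSpace ℝ (Fin 3)) := by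
  intro ψ _ _
  simp

variable {u g : EuclideanSpace ℝ (Fin 3) → EuclideanSpace ℝ (Fin 3)} {L L' : ℕ}

/-- The recursion step: if `∏_{j ≤ L}(𝒞 − j(j+1)) u = 0` then `∏_{j ≤ L+1}(𝒞 − j(j+1)) u = 0`
(the extra factor is applied to the zero field). [folklore] -/
theorem bandDefect_succ_eq_zero (h : bandDefect L u = 0) : bandDefect (L + 1) u = 0 := by
  funext x
  show casimir (bandDefect L u) x - (((L : ℝ) + 1) * ((L : ℝ) + 2)) • bandDefect L u x = 0
  rw [h, casimir_zero]
  simp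

/-- Band-limitedness passes to the next level. [folklore] -/
theorem IsBandLimited.succ (h : IsBandLimited L u) : IsBandLimited (L + 1) u := by
  refine ⟨h.1, fun x => ?_⟩
  have h0 : bandDefect L u = 0 := funext h.2
  rw [bandDefect_succ_eq_zero h0]
  rfl

/-- **Monotonicity of the Casimir cut in the level**: a field band-limited to degrees `≤ L` is
band-limited to degrees `≤ L'` for every `L' ≥ L` (the ranges of the isotypic projections `Π_L`
increase with `L`). [folklore] -/
theorem IsBandLimited.mono (hle : L ≤ L') (h : IsBandLimited L u) : IsBandLimited L' u := by
  induction hle with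
  | refl => exact h
  | step _ ih => exact ih.succ

/-- **Antitonicity of co-band-limitedness**: a field carrying only degrees `> L'` carries only
degrees `> L` for every `L ≤ L'`. [folklore] -/
theorem IsCobandLimited.anti (hle : L ≤ L') (h : IsCobandLimited L' g) : IsCobandLimited L g :=
  fun ψ hψ hc => h ψ (hψ.mono hle) hc

/-- A rung-`L` solution is a rung-`L'` solution for every `L' ≥ L` only on the velocity side; on
the force side co-band-limitedness goes the other way. The velocity half: [folklore] -/
theorem IsRungSolutionOn.isBandLimited_of_le {S : Set ℝ} {ν : ℝ}
    {v : ℝ → EuclideanSpace ℝ (Fin 3) → EuclideanSpace ℝ (Fin 3)}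
    {p : ℝ → EuclideanSpace ℝ (Fin 3) → ℝ}
    {d : ℝ → EuclideanSpace ℝ (Fin 3) → EuclideanSpace ℝ (Fin 3)}
    (h : IsRungSolutionOn S ν L v p d) (hle : L ≤ L') {t : ℝ} (ht : t ∈ S) :
    IsBandLimited L' (v t) :=
  (h.2.1 t ht).mono hle

/-! ## §2 Smooth fields: smoothness and linearity of the cut -/

variable {v : EuclideanSpace ℝ (Fin 3) → EuclideanSpace ℝ (Fin 3)}

/-- `J_a u` unfolded with the bundled cross product: `(J_a u)(x) = C_a(u x) − Du(x)(C_a x)`,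
`C_a = crossCLM (axis a)`. [folklore] -/
theorem angGen_eq (a : Fin 3) (u : EuclideanSpace ℝ (Fin 3) → EuclideanSpace ℝ (Fin 3)) :
    angGen a u = fun x => crossCLM (axis a) (u x) - fderiv ℝ u x (crossCLM (axis a) x) := by
  funext x
  simp [angGen]

/-- **Smooth in, smooth out**: for smooth `u`, `J_a u` is smooth. [folklore] -/
theorem contDiff_angGen (hu : ContDiff ℝ ∞ u) (a : Fin 3) : ContDiff ℝ ∞ (angGen a u) := by
  rw [angGen_eq]
  have hD : ContDiff ℝ ∞ (fderiv ℝ u) := (contDiff_infty_iff_fderiv.1 hu).2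
  exact ((crossCLM (axis a)).contDiff.comp hu).sub (hD.clm_apply (crossCLM (axis a)).contDiff)

/-- For smooth `u`, `𝒞 u` is smooth. [folklore] -/
theorem contDiff_casimir (hu : ContDiff ℝ ∞ u) : ContDiff ℝ ∞ (casimir u) := by
  have h : casimir u = fun x => -∑ a : Fin 3, angGen a (angGen a u) x := rfl
  rw [h]
  exact (ContDiff.sum fun a _ => contDiff_angGen (contDiff_angGen hu a) a).neg

/-- For smooth `u`, every band defect `∏_{j ≤ L}(𝒞 − j(j+1)) u` is smooth. [folklore] -/
theorem contDiff_bandDefect (hu : ContDiff ℝ ∞ u) (L : ℕ) : ContDiff ℝ ∞ (bandDefect L u) := by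
  induction L with
  | zero => exact contDiff_casimir hu
  | succ L ih =>
      change ContDiff ℝ ∞ fun x => casimir (bandDefect L u) x -
        (((L : ℝ) + 1) * ((L : ℝ) + 2)) • bandDefect L u x
      exact (contDiff_casimir ih).sub (ih.const_smul _)

/-- **Additivity of the generators** on differentiable fields. [folklore] -/
theorem angGen_add (hu : Differentiable ℝ u) (hv : Differentiable ℝ v) (a : Fin 3) :
    angGen a (u + v) = angGen a u + angGen a v := by
  funext x
  have hD : fderiv ℝ (u + v) x = fderiv ℝ u x + fderiv ℝ v x := fderiv_add (hu x) (hv x)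
  simp only [angGen_eq, Pi.add_apply, hD, map_add, _root_.add_apply]
  abel

/-- **Homogeneity of the generators** on differentiable fields. [folklore] -/
theorem angGen_smul (hu : Differentiable ℝ u) (c : ℝ) (a : Fin 3) :
    angGen a (c • u) = c • angGen a u := by
  funext x
  have hD : fderiv ℝ (c • u) x = c • fderiv ℝ u x := fderiv_const_smul (hu x) c
  simp only [angGen_eq, Pi.smul_apply, hD, map_smul, _root_.smul_apply, smul_sub]

/-- **Additivity of the Casimir** on smooth fields. [folklore] -/
theorem casimir_add (hu : ContDiff ℝ ∞ u) (hv : ContDiff ℝ ∞ v) :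
    casimir (u + v) = casimir u + casimir v := by
  funext x
  have h1 : ∀ a : Fin 3,
      angGen a (angGen a (u + v)) = angGen a (angGen a u) + angGen a (angGen a v) :=
    fun a => by
      rw [angGen_add (hu.differentiable (by simp)) (hv.differentiable (by simp)),
        angGen_add ((contDiff_angGen hu a).differentiable (by simp))
          ((contDiff_angGen hv a).differentiable (by simp))]
  simp only [casimir, h1, Pi.add_apply, Finset.sum_add_distrib, neg_add]

/-- **Homogeneity of the Casimir** on smooth fields. [folklore] -/
theorem casimir_smul (hu : ContDiff ℝ ∞ u) (c : ℝ) : casimir (c • u) = c • casimir u := by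
  funext x
  have h1 : ∀ a : Fin 3, angGen a (angGen a (c • u)) = c • angGen a (angGen a u) := fun a => by
    rw [angGen_smul (hu.differentiable (by simp)),
      angGen_smul ((contDiff_angGen hu a).differentiable (by simp))]
  simp only [casimir, h1, Pi.smul_apply, ← Finset.smul_sum, smul_neg]

/-- **Additivity of the band defects** on smooth fields. [folklore] -/
theorem bandDefect_add (hu : ContDiff ℝ ∞ u) (hv : ContDiff ℝ ∞ v) (L : ℕ) :
    bandDefect L (u + v) = bandDefect L u + bandDefect L v := by
  induction L with
  | zero => exact casimir_add hu hv
  | succ L ih =>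
      funext x
      change casimir (bandDefect L (u + v)) x -
          (((L : ℝ) + 1) * ((L : ℝ) + 2)) • bandDefect L (u + v) x =
        (casimir (bandDefect L u) x - (((L : ℝ) + 1) * ((L : ℝ) + 2)) • bandDefect L u x) +
        (casimir (bandDefect L v) x - (((L : ℝ) + 1) * ((L : ℝ) + 2)) • bandDefect L v x)
      rw [ih, casimir_add (contDiff_bandDefect hu L) (contDiff_bandDefect hv L)]
      simp only [Pi.add_apply, smul_add]
      abel

/-- **Homogeneity of the band defects** on smooth fields. [folklore] -/
theorem bandDefect_smul (hu : ContDiff ℝ ∞ u) (c : ℝ) (L : ℕ) :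
    bandDefect L (c • u) = c • bandDefect L u := by
  induction L with
  | zero => exact casimir_smul hu c
  | succ L ih =>
      funext x
      change casimir (bandDefect L (c • u)) x -
          (((L : ℝ) + 1) * ((L : ℝ) + 2)) • bandDefect L (c • u) x =
        c • (casimir (bandDefect L u) x - (((L : ℝ) + 1) * ((L : ℝ) + 2)) • bandDefect L u x)
      rw [ih, casimir_smul (contDiff_bandDefect hu L)]
      simp only [Pi.smul_apply, smul_sub, smul_comm c]

/-- **Band-limited fields of degree `≤ L` form a real vector space: sums.** [folklore] -/
theorem IsBandLimited.add (hu : IsBandLimited L u) (hv : IsBandLimited L v) :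
    IsBandLimited L (u + v) := by
  refine ⟨hu.1.add hv.1, fun x => ?_⟩
  rw [bandDefect_add hu.1 hv.1, Pi.add_apply, hu.2 x, hv.2 x, add_zero]

/-- Band-limited fields of degree `≤ L`: scalar multiples. [folklore] -/
theorem IsBandLimited.smul (hu : IsBandLimited L u) (c : ℝ) : IsBandLimited L (c • u) := by
  refine ⟨hu.1.const_smul c, fun x => ?_⟩
  rw [bandDefect_smul hu.1 c, Pi.smul_apply, hu.2 x, smul_zero]

/-- Band-limited fields of degree `≤ L`: negation. [folklore] -/
theorem IsBandLimited.neg (hu : IsBandLimited L u) : IsBandLimited L (-u) := by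
  have h := hu.smul (-1)
  rwa [neg_one_smul] at h

/-- Band-limited fields of degree `≤ L`: differences. [folklore] -/
theorem IsBandLimited.sub (hu : IsBandLimited L u) (hv : IsBandLimited L v) :
    IsBandLimited L (u - v) := by
  rw [sub_eq_add_neg]
  exact hu.add hv.neg

variable {g g' : EuclideanSpace ℝ (Fin 3) → EuclideanSpace ℝ (Fin 3)}

/-- Co-band-limited fields: scalar multiples (no integrability needed). [folklore] -/
theorem IsCobandLimited.smul (hg : IsCobandLimited L g) (c : ℝ) : IsCobandLimited L (c • g) := by
  intro ψ hψ hc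
  simp only [Pi.smul_apply, real_inner_smul_left, integral_const_mul, hg ψ hψ hc, mul_zero]

/-- Co-band-limited fields: negation. [folklore] -/
theorem IsCobandLimited.neg (hg : IsCobandLimited L g) : IsCobandLimited L (-g) := by
  have h := hg.smul (-1)
  rwa [neg_one_smul] at h

/-- Co-band-limited CONTINUOUS fields: sums (continuity makes both pairings with a compactly
supported smooth test field integrable, so the integral splits). [folklore] -/
theorem IsCobandLimited.add (hg : IsCobandLimited L g) (hg' : IsCobandLimited L g')
    (hgc : Continuous g) (hgc' : Continuous g') : IsCobandLimited L (g + g') := by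
  intro ψ hψ hc
  have hψc : Continuous ψ := hψ.1.continuous
  have hsupp : ∀ h : EuclideanSpace ℝ (Fin 3) → EuclideanSpace ℝ (Fin 3),
      HasCompactSupport (fun x => ⟪h x, ψ x⟫) := fun h =>
    hc.mono (Function.support_subset_iff'.2 fun x hx => by
      have hx0 : ψ x = 0 := by simpa [Function.mem_support] using hx
      rw [hx0, inner_zero_right])
  have hi : Integrable fun x => ⟪g x, ψ x⟫ :=
    (hgc.inner hψc).integrable_of_hasCompactSupport (hsupp g)
  have hi' : Integrable fun x => ⟪g' x, ψ x⟫ :=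
    (hgc'.inner hψc).integrable_of_hasCompactSupport (hsupp g')
  simp only [Pi.add_apply, inner_add_left, integral_add hi hi', hg ψ hψ hc, hg' ψ hψ hc, add_zero]

end AngularLadder

end Summit.NavierStokesRegularity.FluidComputer

end
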